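import Summits.QuantumFields.BalabanUV.T4Continuum.Support.NE7CurvedLiftBookkeepingTwoTerm
import HarnessLib

/-!
# NE7CurvedLiftBookkeepingHomTwoTerm — THE ROOT OF THE CURVED (APE) WITH THE HOMOGENEOUS TWO-TERM SLICE-SOLVER LETTER `‖curlAt W X‖ ≤ K_G·g + K_X·R` (`R` any sup bound of `X`):
# the ONLY two-term shape compatible with `S ⊇ {W-tangent skew periodic fields}` (a constant allowance `E_G` on a cone collapses to the one-term letter by scaling `X ↦ tX`, which F128
# refutes); conclusion `SmallField (We^{A}) (x + (K_G(τ + ρ + κ) + K_X(α₀ + a_N) + c_N + 28α₀²))` with `a_N` a displayed sup bound of the normal part (file 64 of the curved (APE))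

Cell `pub-balaban`, rung (B)+1 sub-cell t4, lineage `b2b-balaban-t4-ne7-p1` (CRUX PROVER NE7 #1 = OWNER of row NE7), generation 80; memo
`t4/b2b-balaban-t4-ne7-p1-g80/SLICE-LETTER-OBSTRUCTION.md` §3 PS.  File F134, over F131 `NE7CurvedLiftBookkeepingTwoTerm` (`hess_functional_of_curvedLetters`, `smallField_vary_of_curl`).
WHY.  F131 re-cut the root with a CONSTANT allowance `E_G` and `S` free — correct as a root (the provider chooses `S = {tangent, ‖X‖_∞ ≤ R}`, `E_G = K_X·R`), but the END files F112 … F123d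
fix `hS : S ⊇ {all W-tangent skew periodic fields}`, a CONE: on a cone `‖curl(tX)‖ ≤ K_G·(tg) + E_G` for all `t > 0` forces `‖curl X‖ ≤ K_G·g`, the one-term letter, which F128∕F130
refute.  The shape that is both compatible with a cone and consistent with F128's lower bound and F132's upper bound on gauge modes is HOMOGENEOUS: the allowance is a slope `K_X` times a
sup bound `R` of the field (`K_X ≥ ‖ζ − Ad_{hol}ζ‖∕‖ζ‖ ≍ x` necessary, F128; `K_X = 2x·d(M−1)` sufficient on pure gauge modes, F132; expected `≍ E_W∕M` on the whole slice, memo §3).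
THIS file is the root in that shape; the re-thread of F57 → F123d (memo §3 (v)) should use THIS socket, carrying `K_X·(α₀ + a_N)` next to `c_N` (`a_N = m` from F111's normal lift).
WHAT ([folklore]; 0 def, 0 sorry).  **`smallField_vary_of_curvedLetters_homTwoTerm`** — F55's hypotheses + `hNsup : ‖A_N‖ ≤ a_N` with `hG` homogeneous two-term ⟹
`SmallField (vary W A 1) (x + (K_G(τ + ρ + κ) + K_X(α₀ + a_N) + c_N + 28α₀²))`.
HONEST FRAMING (page 1): bookkeeping over DISPLAYED letters at one configuration; the homogeneous two-term letter is a HYPOTHESIS SHAPE (provider: Bałaban's background-field propagator on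
the gauge-fixed slice + the slice Hodge projection, B9 material, NOT in the tree at curved `W`); nothing of Bałaban's asserted; (APE) on curved data NOT proved; NOT ONE-STEP, NOT NE7;
spine 0∕9; finite T⁴ rung (B)+1 — NOT infinite volume, NOT mass gap, NOT `BetaPertH`, NOT Clay.  Continuum YM on T⁴ ⇐ BetaPertH ∧ nine spine estimates (0/9 proved); BetaPertH ⇐
(D1) ∧ (D4) ∧ CAP+tail; G-an2-4 gates asym, D1 and NE2/3/4.
-/

set_option autoImplicit false

open scoped BigOperators Matrix Matrix.Norms.L2Operator
open NormedSpace Finset Set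

namespace Summit.QuantumFields.BalabanUV.T4Continuum.NE7CurvedLiftBookkeepingHomTwoTerm

open Literature.MathematicalPhysics.QuantumFieldTheory.Balaban1983to89
open B7Prop1Explicit B7Prop2Explicit MatrixLog UnitaryModel
open T4AveragingDeficitWall (IsUnitaryCfg IsSkewDir SmallField vary curlAt dirL1 vary_zero)
open T4AveragingDeficitWallBoundary (IsPeriodicCfg periodBox)
open AveragingDeficitPeriodicCounting (IsPeriodicDir)
open AveragingDeficitMultiLevelPrep (LevelSmall)
open MinimalActionLevels (perWin)
open NE3HessForm (hess dAction)
open NE3TangentCovariantTower (dirIter)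
open AveragingDeficitTransport (norm_Ad_of_unitary)
open NE7CurvedLiftBookkeepingTwoTerm (hess_functional_of_curvedLetters smallField_vary_of_curl)

noncomputable section

variable {d : ℕ} {n : Type*} [Fintype n] [DecidableEq n]

/-- **F55 WITH THE HOMOGENEOUS TWO-TERM LETTER**: F55's hypotheses, a sup bound `a_N` of the normal part, and
`hG : ∀ X ∈ S` periodic W-tangent, `∀ R, (∀ y κ, ‖X y κ‖ ≤ R) → ∀ g ≥ 0, (functional ≤ g) → ‖curlAt W X z μ ν‖ ≤ K_G·g + K_X·R` ⟹
`SmallField (vary W A 1) (x + (K_G(τ + ρ + κ) + K_X(α₀ + a_N) + c_N + 28α₀²))`. [folklore] -/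
theorem smallField_vary_of_curvedLetters_homTwoTerm [Nonempty n] {L : ℕ} (hL : 1 ≤ L) (k : ℕ) {P : ℕ}
    {W : Site d → Fin d → (Matrix n n ℂ)ˣ} (hW : IsUnitaryCfg W)
    {x : ℝ} (hx : 0 ≤ x) (hs : LevelSmall d L k x) (hWx : SmallField W x)
    {A : Site d → Fin d → Matrix n n ℂ} (hA : IsSkewDir A) (hAP : IsPeriodicDir A (P : ℤ)) {α₀ : ℝ} (hAα : ∀ y μ, ‖A y μ‖ ≤ α₀)
    {AN : Site d → Fin d → Matrix n n ℂ} (hNP : IsPeriodicDir AN (P : ℤ)) {aN : ℝ} (hNsup : ∀ y μ, ‖AN y μ‖ ≤ aN)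
    (hNexact : dirIter L (k + 1) W AN = dirIter L (k + 1) W A)
    {cN : ℝ} (hN7 : ∀ z μ ν, μ ≠ ν → ‖curlAt W AN z μ ν‖ ≤ cN)
    (hNorth : ∀ Y : Site d → Fin d → Matrix n n ℂ, IsSkewDir Y → IsPeriodicDir Y (P : ℤ) → dirIter L (k + 1) W Y = 0 →
      hess W AN Y (perWin d P) = 0)
    (S : Set (Site d → Fin d → Matrix n n ℂ)) (hTS : (fun y μ => A y μ - AN y μ) ∈ S) {KG KX : ℝ}
    (hG : ∀ X ∈ S, IsPeriodicDir X (P : ℤ) → dirIter L (k + 1) W X = 0 → ∀ R : ℝ, (∀ y κ', ‖X y κ'‖ ≤ R) → ∀ g : ℝ, 0 ≤ g →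
      (∀ Y : Site d → Fin d → Matrix n n ℂ, IsSkewDir Y → IsPeriodicDir Y (P : ℤ) → dirIter L (k + 1) W Y = 0 →
        |hess W X Y (perWin d P)| ≤ g * dirL1 Y (periodBox (d := d) P)) →
      ∀ z μ ν, μ ≠ ν → ‖curlAt W X z μ ν‖ ≤ KG * g + KX * R)
    {ρ : ℝ} (hρ : 0 ≤ ρ)
    (hEXP : ∀ Y : Site d → Fin d → Matrix n n ℂ, IsSkewDir Y → IsPeriodicDir Y (P : ℤ) →
      |dAction (vary W A 1) Y (perWin d P) - dAction W Y (perWin d P) - hess W A Y (perWin d P)| ≤ ρ * dirL1 Y (periodBox (d := d) P))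
    {κ : ℝ} (hκ : 0 ≤ κ)
    (hWten : ∀ Y : Site d → Fin d → Matrix n n ℂ, IsSkewDir Y → IsPeriodicDir Y (P : ℤ) → dirIter L (k + 1) W Y = 0 →
      |dAction W Y (perWin d P)| ≤ κ * dirL1 Y (periodBox (d := d) P))
    (hcrit : ∀ Y' : Site d → Fin d → Matrix n n ℂ, IsSkewDir Y' → IsPeriodicDir Y' (P : ℤ) → dirIter L (k + 1) (vary W A 1) Y' = 0 →
      dAction (vary W A 1) Y' (perWin d P) = 0)
    {τ : ℝ} (hτ : 0 ≤ τ)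
    (hTT : ∀ Y : Site d → Fin d → Matrix n n ℂ, IsSkewDir Y → IsPeriodicDir Y (P : ℤ) → dirIter L (k + 1) W Y = 0 →
      ∃ Y' : Site d → Fin d → Matrix n n ℂ, IsSkewDir Y' ∧ IsPeriodicDir Y' (P : ℤ) ∧ dirIter L (k + 1) (vary W A 1) Y' = 0 ∧
        |dAction (vary W A 1) (fun y μ => Y' y μ - Y y μ) (perWin d P)| ≤ τ * dirL1 Y (periodBox (d := d) P)) :
    SmallField (vary W A 1) (x + (KG * (τ + ρ + κ) + KX * (α₀ + aN) + cN + 28 * α₀ ^ 2)) := by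
  obtain ⟨hXP, hXT, hsrc⟩ := hess_functional_of_curvedLetters hL k hW hx hs hWx A hAP hNP hNexact hNorth hEXP hWten hcrit hTT
  have hXsup : ∀ y κ', ‖(fun y μ => A y μ - AN y μ) y κ'‖ ≤ α₀ + aN := fun y κ' =>
    (norm_sub_le _ _).trans (add_le_add (hAα y κ') (hNsup y κ'))
  have hcurlX : ∀ z μ ν, μ ≠ ν → ‖curlAt W (fun y κ' => A y κ' - AN y κ') z μ ν‖ ≤ KG * (τ + ρ + κ) + KX * (α₀ + aN) :=
    hG _ hTS hXP hXT (α₀ + aN) hXsup (τ + ρ + κ) (add_nonneg (add_nonneg hτ hρ) hκ) hsrc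
  have h := smallField_vary_of_curl hW hWx hA hAα hN7 hcurlX
  have heq : x + (KG * (τ + ρ + κ) + KX * (α₀ + aN) + cN + 28 * α₀ ^ 2) = x + ((KG * (τ + ρ + κ) + KX * (α₀ + aN)) + cN + 28 * α₀ ^ 2) := by ring
  rw [heq]
  exact h

end

end Summit.QuantumFields.BalabanUV.T4Continuum.NE7CurvedLiftBookkeepingHomTwoTerm
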